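import Summits.PneNP.PneNP.Theorems.Capture.Negative.BoolClosure
import Literature.Computability.Complexity.ExtMonotoneCircuits
import Literature.Computability.Complexity.CircuitComposition
import HarnessLib

/-!
# Crux `Capture` (stmt-PneNP-2659) — duality audit, cell D4: the DUAL-PERM door PASSES for transposition
# generators (Young subgroups): `[τ ∉ ⟨swaps σ i : v i = 0⟩]` is a polynomial `{∧,∨}`-circuit

The open cell of the duality audit (`Cruxes/Capture/DUALITY-AUDIT-c7.md`; kernel door test
`capture_imp_dualPerm`) asks for polynomial extended monotone circuits for

  `DualPerm(σ, τ) : v ↦ [τ ∉ ⟨σ i : v i = 0⟩]`   (`σ i, τ ∈ Sym(Fin d)`).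

This file settles the first NONABELIAN sub-case: every `σ i` is a TRANSPOSITION. Then the groups
`⟨σ i : i ∈ U⟩` are the Young subgroups `∏ Sym(component)` of the graph with edge set `U`, and
`τ ∉ ⟨σ i : i ∈ U⟩` iff some point `x` is separated from `τ x` in that graph (Mathlib's
`mem_closure_isSwap`: a finitary permutation lies in a subgroup generated by swaps iff it maps every point
into its orbit; orbits of the generated subgroup = connected components, `mem_orbit_closure_iff_reflTransGen`).
Separation of `x` from `y` in the graph of the UNselected generators is the Boolean dual of reachability and
obeys the dual Bellman–Ford recursion

  `sep₀(p,q) = [p ≠ q]`,  `sep_{t+1}(p,q) = sep_t(p,q) ∧ ⋀_u (sep_t(p,u) ∨ ⋀_{i : σ i u = q} v_i)`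

(`= ¬ relax`, the tree's reachability-by-relaxation `Capture.Negative.relax`, on the complementary edge
relation), which is a monotone straight-line program: `d` rounds of `d²(2d+1)` unbounded-fan-in `∧/∨` gates
(all in `extGate 1` as width-one CONV gates), `d²` constants and one final `∨` over `x` of `sep_d(x, τ x)`.
Hence `DualPerm` for transposition generators has `{∧,∨}`-circuits of size `≤ 5 (d+1)^4` over `B_1`
(`dualPermSwap_circuit`). [folklore]
-/

namespace Summit.PneNP.PneNP.Theorems.Capture.DualityAudit

set_option linter.dupNamespace false -- `Summit.PneNP.PneNP.…`: summit = sub-problem (D-0017)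

open scoped Classical
open Literature.Computability.Complexity
open Summit.PneNP.PneNP.Theorems.Capture.Negative (relax edgeRel relax_card_iff)

section Orbit

variable {α : Type*}

/-- **Orbits of a subgroup generated by involutions are the connected components of the generator
graph**: `y ∈ (closure S) • x` iff `y` is reachable from `x` by steps `a ↦ s a`, `s ∈ S`. [folklore] -/
theorem mem_orbit_closure_iff_reflTransGen (S : Set (Equiv.Perm α)) (hS : ∀ s ∈ S, ∀ a, s (s a) = a)
    (x y : α) : y ∈ MulAction.orbit (Subgroup.closure S) x ↔
      Relation.ReflTransGen (fun a b => ∃ s ∈ S, s a = b) x y := by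
  constructor
  · rintro ⟨g, rfl⟩
    suffices h : ∀ g ∈ Subgroup.closure S, ∀ x : α,
        Relation.ReflTransGen (fun a b => ∃ s ∈ S, s a = b) x (g x) from h g.1 g.2 x
    intro g hg
    induction hg using Subgroup.closure_induction'' with
    | mem s hs => exact fun x => Relation.ReflTransGen.single ⟨s, hs, rfl⟩
    | inv_mem s hs =>
      intro x
      refine Relation.ReflTransGen.single ⟨s, hs, ?_⟩
      -- an involution is its own inverse
      apply s.injective
      rw [hS s hs, Equiv.Perm.inv_def, Equiv.apply_symm_apply]
    | one => exact fun x => Relation.ReflTransGen.refl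
    | mul g h _ _ ihg ihh =>
      intro x
      rw [Equiv.Perm.mul_apply]
      exact (ihh x).trans (ihg (h x))
  · intro h
    induction h with
    | refl => exact MulAction.mem_orbit_self x
    | @tail b c _ hbc ih =>
      obtain ⟨s, hs, rfl⟩ := hbc
      obtain ⟨g, hg⟩ := ih
      have hg' : g • x = b := hg
      refine ⟨⟨s, Subgroup.subset_closure hs⟩ * g, ?_⟩
      show (⟨s, Subgroup.subset_closure hs⟩ * g) • x = s b
      rw [mul_smul, hg']
      rfl

/-- **DualPerm for transposition generators, combinatorial form**: a permutation of a finite set lies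
OUTSIDE the subgroup generated by a set `S` of transpositions iff some point `x` is NOT connected to `τ x`
in the graph of `S` (Mathlib `mem_closure_isSwap` + the orbit lemma). [folklore] -/
theorem not_mem_closure_swaps_iff [Finite α] [DecidableEq α] (S : Set (Equiv.Perm α)) (hS : ∀ s ∈ S, s.IsSwap)
    (τ : Equiv.Perm α) :
    τ ∉ Subgroup.closure S ↔ ∃ x, ¬ Relation.ReflTransGen (fun a b => ∃ s ∈ S, s a = b) x (τ x) := by
  have hinv : ∀ s ∈ S, ∀ a, s (s a) = a := fun s hs a => by
    obtain ⟨p, q, -, rfl⟩ := hS s hs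
    exact Equiv.swap_apply_self _ _ _
  rw [mem_closure_isSwap hS, not_and_or]
  simp only [Set.toFinite, not_true_eq_false, false_or, not_forall,
    mem_orbit_closure_iff_reflTransGen S hinv]

end Orbit

section Circuit

variable {d n : ℕ}

/-- The dual Bellman–Ford step: `¬ relax` obeys a MONOTONE recursion in the complementary edge data
(`∧` of the old value with an `∧` over intermediate points of `∨`s). [folklore] -/
theorem not_relax_succ (e : Fin d → Fin d → Bool) (t : ℕ) (p q : Fin d) :
    (!relax e (t + 1) p q) = ((!relax e t p q) && decide (∀ u, relax e t p u = false ∨ e u q = false)) := by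
  simp only [relax, Bool.not_or]
  congr 1
  rw [Bool.eq_iff_iff]
  simp only [Bool.not_eq_true', decide_eq_false_iff_not, not_exists, not_and, decide_eq_true_eq,
    Bool.not_eq_true]
  exact forall_congr' fun u => by
    cases relax e t p u <;> simp

/-- **Duality-audit cell D4 (registered sub-goal `dualPermSwap_circuit`)**: for TRANSPOSITION generators
`σ i` the dual-PERM door `v ↦ [τ ∉ ⟨σ i : v i = 0⟩]` is computed by a `{∧,∨}`-circuit (unbounded fan-in
`∧/∨` and constants, all in `extGate 1`) with at most `5 (d + 1)^4` gates: `d` rounds of the dual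
Bellman–Ford recursion for separation in the graph of the unselected transpositions, then `∨_x sep(x, τ x)`.
[folklore] -/
theorem dualPermSwap_circuit : ∀ (d n : ℕ) (σ : Fin n → Equiv.Perm (Fin d)) (τ : Equiv.Perm (Fin d)),
    (∀ i, (σ i).IsSwap) →
    ∃ C : Circuit (Fin n), C.IsOver (extGate 1) ∧ C.size ≤ 5 * (d + 1) ^ 4 ∧
      C.Computes fun v => decide (τ ∉ Subgroup.closure (σ '' {i | v i = false})) := by
  intro d n σ τ hσ
  classical
  -- edge data of the UNselected generators, the iteration state and the monotone layer map
  let e : (Fin n → Bool) → Fin d → Fin d → Bool := fun v a b => decide (∃ i, v i = false ∧ σ i a = b)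
  let κ := Fin n ⊕ (Fin d × Fin d)
  let st : ℕ → (Fin n → Bool) → κ → Bool := fun t v =>
    Sum.elim v fun pq => !relax (e v) t pq.1 pq.2
  let F : (κ → Bool) → κ → Bool := fun x => Sum.elim (fun i => x (Sum.inl i)) fun pq =>
    x (Sum.inr pq) && decide (∀ u, x (Sum.inr (pq.1, u)) = true ∨ ∀ i, σ i u = pq.2 → x (Sum.inl i) = true)
  have hF : ∀ t v, F (st t v) = st (t + 1) v := fun t v => by
    funext w
    rcases w with i | ⟨p, q⟩
    · rfl
    · show (st t v (Sum.inr (p, q)) && decide (∀ u, st t v (Sum.inr (p, u)) = true ∨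
          ∀ i, σ i u = q → st t v (Sum.inl i) = true)) = !relax (e v) (t + 1) p q
      rw [not_relax_succ]
      show ((!relax (e v) t p q) && _) = _
      congr 1
      apply Bool.decide_congr
      refine forall_congr' fun u => ?_
      show ((!relax (e v) t p u) = true ∨ ∀ i, σ i u = q → v i = true) ↔ _
      simp only [Bool.not_eq_true', e, decide_eq_false_iff_not, not_exists, not_and]
      refine or_congr Iff.rfl (forall_congr' fun i => ?_)
      constructor
      · intro h hvi hiu; rw [h hiu] at hvi; exact Bool.noConfusion hvi
      · intro h hiu; cases hv : v i
        · exact absurd hiu (h hv)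
        · rfl
  have hiter : ∀ t v, F^[t] (st 0 v) = st t v := fun t v => by
    induction t with
    | zero => rfl
    | succ t ih => rw [Function.iterate_succ_apply', ih, hF]
  -- the basis: unbounded fan-in ∧/∨ (and the two constants) are width-one CONV gates
  let B : Set GateFn := extGate 1
  have hand : ∀ k, GateFn.and k ∈ B := fun k => (and_isConvGate k).mem_extGate
  have hor : ∀ k, GateFn.or k ∈ B := fun k => (or_isConvGate k).mem_extGate
  -- (1) the layer map costs `d² (2d + 1)` gates
  have hpq : ∀ pq : Fin d × Fin d, CktSize B (fun (x : κ → Bool) (_ : Unit) => F x (Sum.inr pq))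
      (Fintype.card (Fin d) * (0 + 1 + 1) + 0 + 1) := by
    rintro ⟨p, q⟩
    -- the cut of `u → q`: an ∧ over the generators mapping `u` to `q`
    have hcut : ∀ u : Fin d, CktSize B (fun (x : κ → Bool) (_ : Unit) =>
        decide (∀ i, σ i u = q → x (Sum.inl i) = true)) 1 := fun u => by
      let I : Finset (Fin n) := Finset.univ.filter fun i => σ i u = q
      refine (CktSize.gate (B := B) (GateFn.and I.card) (hand _)
        (fun a => Sum.inl ((I.equivFin.symm a).1))).congr fun x _ => ?_
      show decide (∀ a : Fin I.card, x (Sum.inl (I.equivFin.symm a).1) = true) = _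
      apply Bool.decide_congr
      constructor
      · intro h i hi
        have hiI : i ∈ I := by simp [I, hi]
        have := h (I.equivFin ⟨i, hiI⟩)
        simpa using this
      · intro h a
        have ha := (I.equivFin.symm a).2
        simp only [I, Finset.mem_filter, Finset.mem_univ, true_and] at ha
        exact h _ ha
    -- `x (p,u) ∨ cut(u,q)`
    have hor2 : ∀ u : Fin d, CktSize B (fun (x : κ → Bool) (_ : Unit) =>
        (x (Sum.inr (p, u)) || decide (∀ i, σ i u = q → x (Sum.inl i) = true))) (0 + 1 + 1) := fun u => by
      have hp := ((CktSize.proj B fun _ : Unit => (Sum.inr (p, u) : κ)).pair (hcut u)).comp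
        (CktSize.gate (B := B) (GateFn.or 2) (hor 2) (![Sum.inl (), Sum.inr ()]))
      refine hp.congr fun x _ => ?_
      simp only [GateFn.or, Fin.exists_fin_two, Matrix.cons_val_zero, Matrix.cons_val_one, Sum.elim_inl,
        Sum.elim_inr]
      cases x (Sum.inr (p, u)) <;> simp
    -- the ∧ over `u`, together with the old value `x (p,q)`
    have hall := ((CktSize.pi_const hor2).pair (CktSize.proj B fun _ : Unit => (Sum.inr (p, q) : κ))).comp
      (CktSize.gate (B := B) (GateFn.and (Fintype.card (Fin d ⊕ Unit))) (hand _)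
        (fun a => (Fintype.equivFin (Fin d ⊕ Unit)).symm a))
    refine hall.congr fun x _ => ?_
    show decide (∀ a : Fin (Fintype.card (Fin d ⊕ Unit)), Sum.elim
        (fun u => x (Sum.inr (p, u)) || decide (∀ i, σ i u = q → x (Sum.inl i) = true))
        (fun _ : Unit => x (Sum.inr (p, q))) ((Fintype.equivFin (Fin d ⊕ Unit)).symm a) = true) =
      (x (Sum.inr (p, q)) && decide (∀ u, x (Sum.inr (p, u)) = true ∨
        ∀ i, σ i u = q → x (Sum.inl i) = true))
    rw [Bool.eq_iff_iff]
    simp only [decide_eq_true_eq, Bool.and_eq_true]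
    constructor
    · intro h
      refine ⟨?_, fun u => ?_⟩
      · have := h (Fintype.equivFin _ (Sum.inr ()))
        simpa using this
      · have := h (Fintype.equivFin _ (Sum.inl u))
        simpa using this
    · rintro ⟨hq, hu⟩ a
      rcases hw : (Fintype.equivFin (Fin d ⊕ Unit)).symm a with u | u
      · simpa using hu u
      · simpa using hq
  have hlayer : CktSize B F (d * d * (2 * d + 1)) :=
    (((CktSize.proj B (Sum.inl : Fin n → κ)).pair (CktSize.pi_const hpq)).congr fun x w => by
      rcases w with i | pq <;> rfl).of_le (by
        simp only [Fintype.card_fin, Fintype.card_prod]; ring_nf; omega)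
  -- (2) the initial state `st 0 v = (v, [p ≠ q])` costs `d²` constant gates
  have hst0 : CktSize B (st 0) (d * d) := by
    refine CktSize.of_le ?_ (s := 0 + Fintype.card (Fin d × Fin d) * 1)
      (by simp only [Fintype.card_fin, Fintype.card_prod]; omega)
    refine ((CktSize.id B).pair (CktSize.pi_const (f := fun (v : Fin n → Bool) (pq : Fin d × Fin d) =>
      !relax (e v) 0 pq.1 pq.2) fun pq => ?_)).congr fun v w => by rcases w with i | pq <;> rfl
    rcases pq with ⟨p, q⟩
    by_cases hpq : p = q
    · refine (CktSize.gate (B := B) (GateFn.or 0) (hor 0) Fin.elim0).congr fun v _ => ?_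
      simp [GateFn.or, relax, hpq]
    · refine (CktSize.gate (B := B) (GateFn.and 0) (hand 0) Fin.elim0).congr fun v _ => ?_
      simp [GateFn.and, relax, hpq]
  -- (3) `d` rounds, then `∨_x sep(x, τ x)`
  have hrounds : CktSize B (st (Fintype.card (Fin d))) (d * d + Fintype.card (Fin d) * (d * d * (2 * d + 1))) :=
    (hst0.comp (hlayer.iterate (Fintype.card (Fin d)))).congr fun v w => by
      show (F^[Fintype.card (Fin d)]) (st 0 v) w = _
      rw [hiter]
  have hout : CktSize B (fun (y : κ → Bool) (_ : Unit) =>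
      decide (∃ x : Fin d, y (Sum.inr (x, τ x)) = true)) 1 := by
    refine (CktSize.gate (B := B) (GateFn.or d) (hor d) fun a => (Sum.inr (a, τ a) : κ)).congr fun y _ => ?_
    rfl
  have htotal := hrounds.comp hout
  obtain ⟨C, hC, hs, he⟩ := htotal.toCircuit
  refine ⟨C, hC, hs.trans ?_, fun v => ?_⟩
  · -- size bookkeeping: `d² + d · d²(2d+1) + 1 ≤ 5 (d+1)^4`
    rw [Fintype.card_fin]
    have h1 : d * d ≤ (d + 1) ^ 4 := by
      calc d * d ≤ (d + 1) * (d + 1) := Nat.mul_le_mul (Nat.le_succ d) (Nat.le_succ d)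
        _ = (d + 1) ^ 2 := (sq (d + 1)).symm
        _ ≤ (d + 1) ^ 4 := Nat.pow_le_pow_right (Nat.succ_pos d) (by norm_num)
    have h2 : d * (d * d * (2 * d + 1)) ≤ 3 * (d + 1) ^ 4 := by
      have : 2 * d + 1 ≤ 3 * (d + 1) := by omega
      calc d * (d * d * (2 * d + 1)) ≤ (d + 1) * ((d + 1) * (d + 1) * (3 * (d + 1))) := by
            gcongr <;> omega
        _ = 3 * (d + 1) ^ 4 := by ring
    have h3 : 1 ≤ (d + 1) ^ 4 := Nat.one_le_pow _ _ (Nat.succ_pos d)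
    omega
  · rw [he v]
    show decide (∃ x : Fin d, st (Fintype.card (Fin d)) v (Sum.inr (x, τ x)) = true) = _
    apply Bool.decide_congr
    show (∃ x : Fin d, (!relax (e v) (Fintype.card (Fin d)) x (τ x)) = true) ↔ _
    rw [not_mem_closure_swaps_iff _ (by rintro _ ⟨i, -, rfl⟩; exact hσ i)]
    refine exists_congr fun x => ?_
    rw [Bool.not_eq_true', ← Bool.not_eq_true, relax_card_iff]
    -- the two edge relations agree
    have hrel : edgeRel (e v) = fun a b => ∃ s ∈ σ '' {i | v i = false}, s a = b := by
      funext a b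
      simp only [edgeRel, e, decide_eq_true_eq, Set.mem_image, Set.mem_setOf_eq, eq_iff_iff]
      constructor
      · rintro ⟨i, hi, hab⟩; exact ⟨σ i, ⟨i, hi, rfl⟩, hab⟩
      · rintro ⟨_, ⟨i, hi, rfl⟩, hab⟩; exact ⟨i, hi, hab⟩
    rw [hrel]

end Circuit

end Summit.PneNP.PneNP.Theorems.Capture.DualityAudit
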